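import Summits.QuantumFields.YangMills.Theorems.BalabanUVNodesN07DatumGauge152Guarded
import Literature.MathematicalPhysics.QuantumFieldTheory.Balaban1983to89.Node00.TorusCoverGaugeTokens152153BoxUniformBox
import HarnessLib

/-!
# N07 [B11] (= [15] = [Balaban1985Variational]) Sect. F, sub-target S3 — **THE GUARDED (152)∕(153) DOOR AT A BOX-FORM DATUM**: this seat's p631846
# `datumGauge152_REfiner153_of_prop6P_of_floor ∕ _guarded ∕ _guarded_of_dvd` with the meeting premise in the shape of dag-n07-e's CLEAN CLAUSE
# (`…N07SplitClauseLevelRaising.datumGaugeSplitTopStepCoreG_of_clean`, p639318 :374): `∃ x ∈ box L (cornerP Mc ρ a) (sideP Mc ρ) j, ∃ y, π y ∈ Ω_j(s) ∧ Within 3 x y`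

Cell `pub-ymgap`, width seat `pub-ymgap-dag-n07-w3` generation 7, CLAIM-3 ∕ INTENT-3 (B) (cell INBOX 2026-08-28; trigger (t3) named by dag-n07-e g22's CLAIM-57a).  `--kind proof
--supports stmt-QuantumFields-27364 --as helper` (K1⁹; count-neutral; def-free).  [15] = [Balaban1985Variational]; [6] = [Balaban1985RegularSpaces]; [B6] = [Balaban1984PropagatorsII];
[I] = [Balaban1987RG1].

THE POINT.  After dag-n07-e's LOCATED-INWARD-DATUM and level-raising reduction, the S6 head's knit (`…N07SplitClauseHeadKnit` v2, `pub-ymgap-dag-n07-w4`) proves only the CLEAN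
clause, whose datum is met through a point of the PRINT BOX `box L (cornerP Mc ρ a) (sideP Mc ρ) j` (not of the grid cube).  The S3 call there is this file's ★★★
`datumGauge152_REfiner153_of_prop6P_guarded_box`: p631846's guarded door with that premise, every other binder and the six output clauses byte-identical; the collar now comes from
dag-n07-e's module 57a through this seat's box-form sibling `Node00.TorusCoverGaugeTokens152153BoxUniformBox`, the floor ∕ non-wrapping ∕ `j ≤ m + K` ∕ radii ceiling from the guard
exactly as in p631846 (§1 there, BY NAME).

WHAT IS PROVED (sorry-free; no definition; axioms standard).  ★★★ `datumGauge152_REfiner153_of_prop6P_of_floor_box` · ★★★ `datumGauge152_REfiner153_of_prop6P_guarded_box` ·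
★ `datumGauge152_REfiner153_of_prop6P_guarded_box_of_dvd` — p631846's §2 with `hdat : ∃ x ∈ box …, ∃ y, …`.
HONEST SCOPE.  Count-neutral kernel-lane bookkeeping: one premise re-shaped, p631846 §1 and the box-form uniform door consumed BY NAME, nothing restated; [6] Proposition 6 on
print's class is the HYPOTHESIS `hP6` (N05 ∕ stub 2′), applied once per datum; NOTHING of [15]∕[6]∕[B6] analysis asserted; `DatumGaugeSplitTopStepCoreG` ∕ `HalvingStepTop(Core)G` ∕
`Prop8RegSepTopStepG` ∕ `stub_prop8StepCoP13` ∕ K0⁷ ∕ K1⁹ NOT closed; N07 ∕ N05 NOT discharged; counts unmoved (the chair's tally is the only count); one finite 𝕋⁴ programme at fixed ε —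
R4 closes the conditional finite-𝕋⁴ rung `BalabanLadder.UV` ONLY; the YM mass gap (Clay) is NOT proved by any of this; nothing continuum ∕ ℝ⁴ ∕ infinite volume ∕ OS.  No `sorry`,
no `def`, no `instance`, no `notation`.

RELATED IN THE TREE, NOT DUPLICATED: p631846 `…N07DatumGauge152Guarded` (the grid-cube-witness doors + §1 arithmetic — CONSUMED), `Node00/TorusCoverGaugeTokens152153BoxUniformBox`
(the box-form uniform door — CONSUMED), dag-n07-e `…N07SplitClauseLevelRaising` (the clean clause — the CONSUMER's premise shape), `Node00/TorusCoverCollarOfMeetsPrintBox` (57a).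

References: T. Bałaban, CMP **102** (1985) 277–309 [Balaban1985Variational] (144) p.300, (150)–(153) p.301, p.304 lines 1–2; CMP **99** (1985) 75–102 [Balaban1985RegularSpaces]
Prop. 6 (1.135)–(1.138) p.99, p.98; CMP **96** (1984) 223–250 [Balaban1984PropagatorsII] (2.10)–(2.12) p.225; CMP **109** (1987) 249–301 [Balaban1987RG1] (0.1) p.251.
-/

set_option autoImplicit false

noncomputable section

namespace Summit.QuantumFields.YangMills.BalabanUVNodes.N07DatumGauge152GuardedBox

open scoped Matrix.Norms.L2Operator InnerProductSpace RealInnerProductSpace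
open Literature.MathematicalPhysics.QuantumFieldTheory.Balaban1983to89
open Literature.MathematicalPhysics.QuantumFieldTheory.Balaban1983to89.Node00
open Literature.MathematicalPhysics.QuantumFieldTheory.Balaban1983to89.B12RegularSpaces111 (gaugeU expI grad)
open Literature.MathematicalPhysics.QuantumFieldTheory.Balaban1983to89.B15DeterminingSets
open T4Continuum (T4Family)
open B15Eq112TorusCover (cover)
open B14DomainGeom (Pt Within)
open B14.Eq213MaximalDomains (side cubeExt)
open B8Eq131Cubes (box cube)
open B8LeafModelZd (ZdIdx)
open B6SectADomainsV1 (Domains)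
open B6SectAOperatorsV1 (RE dsE QpE)
open Literature.MathematicalPhysics.QuantumFieldTheory.BalabanImbrieJaffe1984to88.BIJ85AxialPropagator411 (BondSpace)
open Summit.QuantumFields.YangMills.BalabanUVNodes.N07DatumGauge152Guarded (sitesPerDir_le_sitesPerDir_of_le le_m_add_K_of_three_le_sitesPerDir
  two_mul_pow_le_sitesPerDir_of_levelGuard injOn_cover_cube_cornerP_of_le_sitesPerDir)

section Door

variable {F : T4Family} {N : ℕ} [NeZero N]

/-- ★★★ **THE (152)∕(153) `Within`-WITNESS DOOR WITH THE KNIT's SIDE CONDITIONS DISCHARGED — FLOOR FORM, BOX-FORM DATUM** (p631846's `…_of_floor` with the meeting premise on the PRINT BOX, dag-n07-e's clean-clause shape `∃ x ∈ box L (cornerP Mc ρ a) (sideP Mc ρ) j, ∃ y, π y ∈ Ω_j(s) ∧ Within 3 x y`; door = this seat's box-form sibling `gauge152_REfiner153_box_of_within_box_of_prop6P_uniform`). ([15] p. 300: *«Let us take a cube □ intersecting Ω_j but not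
Ω_{j+1}»*; (144), (150)–(153) p. 301).  Binders in the order of `N07LocalLettersCoreGuarded.DatumGaugeSplitTopStepCoreG` at `Sup := suppDomOfRecord`: [6] Prop. 6 on print's
class at collar `ρ` — the HYPOTHESIS `hP6`; the grid-cube letter `1 ≤ Mc`; the prefix `ν M g K k s`, `L ≤ ρ`, separation; the FLOOR `(11·4 + 4ρ + Mc + 3)·L ≤ ν.M₁` and the
TOP-LEVEL PERIOD BOUND `Mc + 11·4 + 6ρ ≤ sitesPerDir k`; radii `0 < ε_m ≤ a₀ ≤ a0OfP F N Mc ρ B₁ c₁`, `ε_m ≤ 2ε_{m+1}`; `U` in the (1.7)∕(1.9)-Top classes over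
`suppDomOfRecord`; the DATUM `1 ≤ j ≤ k`, `a`, and the clean clause's witness `∃ x ∈ box L (cornerP Mc ρ a) (sideP Mc ρ) j, ∃ y, π y ∈ Ω_j(s) ∧ Within 3 x y`.  CONCLUSION = generation 6's:
ONE gauge `u`, ONE potential `A` — the gauge equation on the bonds of `regionOfSet (π '' box L (cornerP Mc ρ a) (sideP Mc ρ) j)`, `‖A‖, ‖∇A‖ < b9OfP F Mc ρ B₁ · ε_j` there,
`‖∂*∂A‖, ‖ΔA‖ < …` on its deep bonds, and for every proof of `j ≤ m + K`, every `D′` with `ker Q′_{D′} ≤ ker Q′_{cubeDomains (cornerP Mc ρ a) (sideP Mc ρ) ρ j}` and every `φ`,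
`RE D′ η_j⁻¹ (dsE η_j⁻¹ (Re ∕ Im(φ∘A))) = 0`.  Proof: `j ≤ m + K` and the non-wrapping from the period bound (§1), `M₀ := Mc` (`Or.inl rfl`), the ceiling via `a₀ ≤ a0OfP`,
then the box-form uniform door BY NAME at `Dw := 3`.
[cite: Balaban1985Variational, (144) p.300, (150)–(153) p.301, p.304 lines 1–2; Balaban1985RegularSpaces, Prop. 6 (1.135)–(1.138) p.99, p.98; Balaban1984PropagatorsII, (2.10)–(2.12) p.225; Balaban1987RG1, (0.1) p.251] -/
theorem datumGauge152_REfiner153_of_prop6P_of_floor_box {B₁ c₁ : ℝ} (hB₁ : 0 ≤ B₁) (hc₁ : 0 < c₁) {ρ : ℕ}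
    (hP6 : letI : CStarAlgebra (MatA N) := {}; B8.Prop6Printed 4 (F.L : ℝ) B₁ c₁ (fun i : ZdIdx 4 F.L => zdCubP (MatA N) F.L ρ i)) {Mc : ℕ} (hMc : 1 ≤ Mc)
    (ν : Stage7Numerics) {M : ℕ} (g : ℕ → ℝ) (K k : ℕ) (hρ : (F.P K).L ≤ ρ) (s : SeqOfRecord F ν M g K k) (hsep : Sect2.SeqSeparated ν.M₁ s)
    (hfl : (11 * 4 + 4 * ρ + Mc + 3) * F.L ≤ ν.M₁) (hlev : Mc + 11 * 4 + 6 * ρ ≤ (F.P K).sitesPerDir k)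
    (ε : ℕ → ℝ) {a₀ : ℝ} (ha₀ : a₀ ≤ a0OfP F N Mc ρ B₁ c₁)
    (hε : ∀ m, m ≤ k → 0 < ε m ∧ ε m ≤ a₀) (hcomp : ∀ m, m < k → ε m ≤ 2 * ε (m + 1))
    (U : GaugeField (F.P K) 0 (SU N))
    (h17 : ∀ m, m ≤ k → PlaqSmallOn (Sect2.omegaPlaqsTop s.Ω (suppDomOfRecord F ν K s.Ω) m) (ε m * (F.P K).eta m ^ 2) U)
    (h19 : ∀ m, m ≤ k → Sect2.CoDivSmallOn (Sect2.omegaBondsTop s.Ω (suppDomOfRecord F ν K s.Ω) m) (ε m * (F.P K).eta m ^ 3) U)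
    {j : ℕ} (hj1 : 1 ≤ j) (hjk : j ≤ k) (a : Pt (F.P K).d)
    (hdat : ∃ x ∈ box (F.P K).L (cornerP (F.P K) Mc ρ a) (sideP (F.P K) Mc ρ) j, ∃ y : Pt (F.P K).d, cover (F.P K) y ∈ s.Ω j ∧ Within ((3 : ℕ) : ℤ) x y) :
    ∃ u : GaugeTransf (F.P K) 0 (SU N), ∃ A : PBond (F.P K) 0 → MatA N,
      (∀ b ∈ (Sect2.regionOfSet (F.P K) (cover (F.P K) '' box (F.P K).L (cornerP (F.P K) Mc ρ a) (sideP (F.P K) Mc ρ) j)).bonds,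
          gaugeU (fun x => ιSU N (u x)) (fun b' => ιSU N (U b')) b = expI ((F.P K).eta j) (A b)) ∧
      (∀ b ∈ (Sect2.regionOfSet (F.P K) (cover (F.P K) '' box (F.P K).L (cornerP (F.P K) Mc ρ a) (sideP (F.P K) Mc ρ) j)).bonds,
          ‖A b‖ < b9OfP F Mc ρ B₁ * ε j) ∧
      (∀ q ∈ (Sect2.regionOfSet (F.P K) (cover (F.P K) '' box (F.P K).L (cornerP (F.P K) Mc ρ a) (sideP (F.P K) Mc ρ) j)).dpairs,
          ‖grad ((F.P K).eta j) q.2.1 (fun y => A ⟨y, q.2.2⟩) q.1‖ < b9OfP F Mc ρ B₁ * ε j) ∧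
      (∀ b ∈ Sect2.bondsDeep (cover (F.P K) '' box (F.P K).L (cornerP (F.P K) Mc ρ a) (sideP (F.P K) Mc ρ) j),
          ‖Sect2.codiffCurlA ((F.P K).eta j) A b.src b.dir‖ < b9OfP F Mc ρ B₁ * ε j) ∧
      (∀ b ∈ Sect2.bondsDeep (cover (F.P K) '' box (F.P K).L (cornerP (F.P K) Mc ρ a) (sideP (F.P K) Mc ρ) j),
          ‖∑ ν' : Fin (F.P K).d, (((F.P K).eta j : ℝ) : ℂ)⁻¹ •
              (grad ((F.P K).eta j) ν' (fun y => A ⟨y, b.dir⟩) (b.src.unshift ν') - grad ((F.P K).eta j) ν' (fun y => A ⟨y, b.dir⟩) b.src)‖ <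
            b9OfP F Mc ρ B₁ * ε j) ∧
      (∀ (hjK : j ≤ (F.P K).m + (F.P K).K) (D' : Domains (F.P K)),
        LinearMap.ker (QpE D') ≤ LinearMap.ker (QpE (cubeDomains (F.P K) (cornerP (F.P K) Mc ρ a) (sideP (F.P K) Mc ρ) ρ j hjK)) →
        ∀ φ : MatA N →L[ℂ] ℂ,
          RE D' ((F.P K).eta j)⁻¹ (dsE ((F.P K).eta j)⁻¹ (WithLp.toLp 2 fun b => (φ (A b)).re : BondSpace (F.P K))) = 0 ∧
          RE D' ((F.P K).eta j)⁻¹ (dsE ((F.P K).eta j)⁻¹ (WithLp.toLp 2 fun b => (φ (A b)).im : BondSpace (F.P K))) = 0) := by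
  letI : CStarAlgebra (MatA N) := {}
  -- the level range and the non-wrapping, from the top-level period bound (§1)
  have hlev' : Mc + 11 * (F.P K).d + 6 * ρ ≤ (F.P K).sitesPerDir k := by rw [T4Family.P_d]; exact hlev
  have hjK : j ≤ (F.P K).m + (F.P K).K :=
    le_m_add_K_of_three_le_sitesPerDir (le_trans (by omega) (hlev.trans (sitesPerDir_le_sitesPerDir_of_le hjk)))
  have hinj : Set.InjOn (cover (F.P K)) (cube (F.P K).L (cornerP (F.P K) Mc ρ a) (sideP (F.P K) Mc ρ) ρ j 0) :=
    injOn_cover_cube_cornerP_of_le_sitesPerDir hj1 hjk hρ a hlev'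
  -- the radii ceiling through `a₀ ≤ a0OfP`
  have hε' : ∀ m, m ≤ k → 0 < ε m ∧ ε m ≤ a0OfP F N Mc ρ B₁ c₁ := fun m hm => ⟨(hε m hm).1, (hε m hm).2.trans ha₀⟩
  obtain ⟨x, hx, y, hy, hxy⟩ := hdat
  obtain ⟨u, A, h1, h2, h3, h4, h5, h6⟩ :=
    gauge152_REfiner153_box_of_within_box_of_prop6P_uniform hB₁ hc₁ hP6 hMc ν g K k hρ s hsep ε hε' hcomp U h17 h19 hj1 hjk hjK
      (Or.inl rfl) hfl a hx hy hxy hinj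
  exact ⟨u, A, h1, h2, h3, h4, h5, fun _ D' hD' φ => h6 D' hD' φ⟩

/-- ★★★ **THE SAME KEYED ON THE PLAN's V20-G GUARD, BOX-FORM DATUM** `c ≤ ν.M₁ ∧ k + c₀ ≤ F.m + K` (dag-n07-e `K0-ROAD-CHAIN-CHECKLIST` § UPDATE g21; the S6 head's `Adm` instance), the two
constants' side conditions stated ONCE: `(11·4 + 4ρ + Mc + 3)·L ≤ c` (print p. 304 lines 1–2 «R₁M₁ sufficiently big») and `Mc + 11·4 + 6ρ ≤ 2·L^{c₀}` ([I] (0.1): the windows of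
an actual run do not wrap).  Inside the token the hypothesis `hadm` IS the guard's value at the prefix (β-reduced); everything else as in the floor form.
[cite: Balaban1985Variational, (144) p.300, (150)–(153) p.301, p.304 lines 1–2; Balaban1985RegularSpaces, Prop. 6 p.99, p.98, (1.3)–(1.6) p.77; Balaban1984PropagatorsII, (2.12) p.225; Balaban1987RG1, (0.1) p.251] -/
theorem datumGauge152_REfiner153_of_prop6P_guarded_box {B₁ c₁ : ℝ} (hB₁ : 0 ≤ B₁) (hc₁ : 0 < c₁) {ρ : ℕ}
    (hP6 : letI : CStarAlgebra (MatA N) := {}; B8.Prop6Printed 4 (F.L : ℝ) B₁ c₁ (fun i : ZdIdx 4 F.L => zdCubP (MatA N) F.L ρ i)) {Mc : ℕ} (hMc : 1 ≤ Mc)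
    {c c₀ : ℕ} (hc : (11 * 4 + 4 * ρ + Mc + 3) * F.L ≤ c) (hc₀ : Mc + 11 * 4 + 6 * ρ ≤ 2 * F.L ^ c₀)
    (ν : Stage7Numerics) {M : ℕ} (g : ℕ → ℝ) (K k : ℕ) (hρ : (F.P K).L ≤ ρ) (s : SeqOfRecord F ν M g K k) (hsep : Sect2.SeqSeparated ν.M₁ s)
    (hadm : c ≤ ν.M₁ ∧ k + c₀ ≤ F.m + K)
    (ε : ℕ → ℝ) {a₀ : ℝ} (ha₀ : a₀ ≤ a0OfP F N Mc ρ B₁ c₁)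
    (hε : ∀ m, m ≤ k → 0 < ε m ∧ ε m ≤ a₀) (hcomp : ∀ m, m < k → ε m ≤ 2 * ε (m + 1))
    (U : GaugeField (F.P K) 0 (SU N))
    (h17 : ∀ m, m ≤ k → PlaqSmallOn (Sect2.omegaPlaqsTop s.Ω (suppDomOfRecord F ν K s.Ω) m) (ε m * (F.P K).eta m ^ 2) U)
    (h19 : ∀ m, m ≤ k → Sect2.CoDivSmallOn (Sect2.omegaBondsTop s.Ω (suppDomOfRecord F ν K s.Ω) m) (ε m * (F.P K).eta m ^ 3) U)
    {j : ℕ} (hj1 : 1 ≤ j) (hjk : j ≤ k) (a : Pt (F.P K).d)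
    (hdat : ∃ x ∈ box (F.P K).L (cornerP (F.P K) Mc ρ a) (sideP (F.P K) Mc ρ) j, ∃ y : Pt (F.P K).d, cover (F.P K) y ∈ s.Ω j ∧ Within ((3 : ℕ) : ℤ) x y) :
    ∃ u : GaugeTransf (F.P K) 0 (SU N), ∃ A : PBond (F.P K) 0 → MatA N,
      (∀ b ∈ (Sect2.regionOfSet (F.P K) (cover (F.P K) '' box (F.P K).L (cornerP (F.P K) Mc ρ a) (sideP (F.P K) Mc ρ) j)).bonds,
          gaugeU (fun x => ιSU N (u x)) (fun b' => ιSU N (U b')) b = expI ((F.P K).eta j) (A b)) ∧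
      (∀ b ∈ (Sect2.regionOfSet (F.P K) (cover (F.P K) '' box (F.P K).L (cornerP (F.P K) Mc ρ a) (sideP (F.P K) Mc ρ) j)).bonds,
          ‖A b‖ < b9OfP F Mc ρ B₁ * ε j) ∧
      (∀ q ∈ (Sect2.regionOfSet (F.P K) (cover (F.P K) '' box (F.P K).L (cornerP (F.P K) Mc ρ a) (sideP (F.P K) Mc ρ) j)).dpairs,
          ‖grad ((F.P K).eta j) q.2.1 (fun y => A ⟨y, q.2.2⟩) q.1‖ < b9OfP F Mc ρ B₁ * ε j) ∧
      (∀ b ∈ Sect2.bondsDeep (cover (F.P K) '' box (F.P K).L (cornerP (F.P K) Mc ρ a) (sideP (F.P K) Mc ρ) j),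
          ‖Sect2.codiffCurlA ((F.P K).eta j) A b.src b.dir‖ < b9OfP F Mc ρ B₁ * ε j) ∧
      (∀ b ∈ Sect2.bondsDeep (cover (F.P K) '' box (F.P K).L (cornerP (F.P K) Mc ρ a) (sideP (F.P K) Mc ρ) j),
          ‖∑ ν' : Fin (F.P K).d, (((F.P K).eta j : ℝ) : ℂ)⁻¹ •
              (grad ((F.P K).eta j) ν' (fun y => A ⟨y, b.dir⟩) (b.src.unshift ν') - grad ((F.P K).eta j) ν' (fun y => A ⟨y, b.dir⟩) b.src)‖ <
            b9OfP F Mc ρ B₁ * ε j) ∧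
      (∀ (hjK : j ≤ (F.P K).m + (F.P K).K) (D' : Domains (F.P K)),
        LinearMap.ker (QpE D') ≤ LinearMap.ker (QpE (cubeDomains (F.P K) (cornerP (F.P K) Mc ρ a) (sideP (F.P K) Mc ρ) ρ j hjK)) →
        ∀ φ : MatA N →L[ℂ] ℂ,
          RE D' ((F.P K).eta j)⁻¹ (dsE ((F.P K).eta j)⁻¹ (WithLp.toLp 2 fun b => (φ (A b)).re : BondSpace (F.P K))) = 0 ∧
          RE D' ((F.P K).eta j)⁻¹ (dsE ((F.P K).eta j)⁻¹ (WithLp.toLp 2 fun b => (φ (A b)).im : BondSpace (F.P K))) = 0) := by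
  letI : CStarAlgebra (MatA N) := {}
  -- the floor half of the guard ⇒ the collar floor; the level half ⇒ the top-level period bound `Mc + 44 + 6ρ ≤ 2L^{c₀} ≤ sitesPerDir k`
  have hfl : (11 * 4 + 4 * ρ + Mc + 3) * F.L ≤ ν.M₁ := hc.trans hadm.1
  have hlevP : k + c₀ ≤ (F.P K).m + (F.P K).K := by rw [T4Family.P_m, T4Family.P_K]; exact hadm.2
  have hlev : Mc + 11 * 4 + 6 * ρ ≤ (F.P K).sitesPerDir k := by
    refine hc₀.trans ?_
    have := two_mul_pow_le_sitesPerDir_of_levelGuard (P := F.P K) le_rfl hlevP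
    rwa [T4Family.P_L] at this
  exact datumGauge152_REfiner153_of_prop6P_of_floor_box hB₁ hc₁ hP6 hMc ν g K k hρ s hsep hfl hlev ε ha₀ hε hcomp U h17 h19 hj1 hjk a hdat

/-- ★ **THE GUARDED BOX-FORM DOOR WITH [6] PROPOSITION 6 HELD AT A DIVISOR `ρ₀ ∣ ρ` OF THE COLLAR** (stub 2′ `stub_prop6MemberB8AtP13` supplies Prop. 6 on print's class at SOME
`ρ₀ ≥ 1`; the knit's collar `ρ` — chosen by `exists_halvingBudget` above a threshold and as a multiple of the big block and of `ρ₀` — inherits it by dag-n07-e's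
`prop6Printed_zdCubP_anti`).  Constants `b9OfP F Mc ρ B₁`, `a0OfP F N Mc ρ B₁ c₁` at the knit's `ρ`.
[cite: Balaban1985RegularSpaces, Prop. 6 p.99, p.98 («M is a multiple of R₁M₁»); Balaban1985Variational, (144) p.300, (150)–(153) p.301; Balaban1987RG1, (0.1) p.251] -/
theorem datumGauge152_REfiner153_of_prop6P_guarded_box_of_dvd {B₁ c₁ : ℝ} (hB₁ : 0 ≤ B₁) (hc₁ : 0 < c₁) {ρ₀ ρ : ℕ} (hdvd : ρ₀ ∣ ρ)
    (hP6 : letI : CStarAlgebra (MatA N) := {}; B8.Prop6Printed 4 (F.L : ℝ) B₁ c₁ (fun i : ZdIdx 4 F.L => zdCubP (MatA N) F.L ρ₀ i)) {Mc : ℕ} (hMc : 1 ≤ Mc)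
    {c c₀ : ℕ} (hc : (11 * 4 + 4 * ρ + Mc + 3) * F.L ≤ c) (hc₀ : Mc + 11 * 4 + 6 * ρ ≤ 2 * F.L ^ c₀)
    (ν : Stage7Numerics) {M : ℕ} (g : ℕ → ℝ) (K k : ℕ) (hρ : (F.P K).L ≤ ρ) (s : SeqOfRecord F ν M g K k) (hsep : Sect2.SeqSeparated ν.M₁ s)
    (hadm : c ≤ ν.M₁ ∧ k + c₀ ≤ F.m + K)
    (ε : ℕ → ℝ) {a₀ : ℝ} (ha₀ : a₀ ≤ a0OfP F N Mc ρ B₁ c₁)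
    (hε : ∀ m, m ≤ k → 0 < ε m ∧ ε m ≤ a₀) (hcomp : ∀ m, m < k → ε m ≤ 2 * ε (m + 1))
    (U : GaugeField (F.P K) 0 (SU N))
    (h17 : ∀ m, m ≤ k → PlaqSmallOn (Sect2.omegaPlaqsTop s.Ω (suppDomOfRecord F ν K s.Ω) m) (ε m * (F.P K).eta m ^ 2) U)
    (h19 : ∀ m, m ≤ k → Sect2.CoDivSmallOn (Sect2.omegaBondsTop s.Ω (suppDomOfRecord F ν K s.Ω) m) (ε m * (F.P K).eta m ^ 3) U)
    {j : ℕ} (hj1 : 1 ≤ j) (hjk : j ≤ k) (a : Pt (F.P K).d)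
    (hdat : ∃ x ∈ box (F.P K).L (cornerP (F.P K) Mc ρ a) (sideP (F.P K) Mc ρ) j, ∃ y : Pt (F.P K).d, cover (F.P K) y ∈ s.Ω j ∧ Within ((3 : ℕ) : ℤ) x y) :
    ∃ u : GaugeTransf (F.P K) 0 (SU N), ∃ A : PBond (F.P K) 0 → MatA N,
      (∀ b ∈ (Sect2.regionOfSet (F.P K) (cover (F.P K) '' box (F.P K).L (cornerP (F.P K) Mc ρ a) (sideP (F.P K) Mc ρ) j)).bonds,
          gaugeU (fun x => ιSU N (u x)) (fun b' => ιSU N (U b')) b = expI ((F.P K).eta j) (A b)) ∧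
      (∀ b ∈ (Sect2.regionOfSet (F.P K) (cover (F.P K) '' box (F.P K).L (cornerP (F.P K) Mc ρ a) (sideP (F.P K) Mc ρ) j)).bonds,
          ‖A b‖ < b9OfP F Mc ρ B₁ * ε j) ∧
      (∀ q ∈ (Sect2.regionOfSet (F.P K) (cover (F.P K) '' box (F.P K).L (cornerP (F.P K) Mc ρ a) (sideP (F.P K) Mc ρ) j)).dpairs,
          ‖grad ((F.P K).eta j) q.2.1 (fun y => A ⟨y, q.2.2⟩) q.1‖ < b9OfP F Mc ρ B₁ * ε j) ∧
      (∀ b ∈ Sect2.bondsDeep (cover (F.P K) '' box (F.P K).L (cornerP (F.P K) Mc ρ a) (sideP (F.P K) Mc ρ) j),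
          ‖Sect2.codiffCurlA ((F.P K).eta j) A b.src b.dir‖ < b9OfP F Mc ρ B₁ * ε j) ∧
      (∀ b ∈ Sect2.bondsDeep (cover (F.P K) '' box (F.P K).L (cornerP (F.P K) Mc ρ a) (sideP (F.P K) Mc ρ) j),
          ‖∑ ν' : Fin (F.P K).d, (((F.P K).eta j : ℝ) : ℂ)⁻¹ •
              (grad ((F.P K).eta j) ν' (fun y => A ⟨y, b.dir⟩) (b.src.unshift ν') - grad ((F.P K).eta j) ν' (fun y => A ⟨y, b.dir⟩) b.src)‖ <
            b9OfP F Mc ρ B₁ * ε j) ∧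
      (∀ (hjK : j ≤ (F.P K).m + (F.P K).K) (D' : Domains (F.P K)),
        LinearMap.ker (QpE D') ≤ LinearMap.ker (QpE (cubeDomains (F.P K) (cornerP (F.P K) Mc ρ a) (sideP (F.P K) Mc ρ) ρ j hjK)) →
        ∀ φ : MatA N →L[ℂ] ℂ,
          RE D' ((F.P K).eta j)⁻¹ (dsE ((F.P K).eta j)⁻¹ (WithLp.toLp 2 fun b => (φ (A b)).re : BondSpace (F.P K))) = 0 ∧
          RE D' ((F.P K).eta j)⁻¹ (dsE ((F.P K).eta j)⁻¹ (WithLp.toLp 2 fun b => (φ (A b)).im : BondSpace (F.P K))) = 0) := by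
  letI : CStarAlgebra (MatA N) := {}
  exact datumGauge152_REfiner153_of_prop6P_guarded_box hB₁ hc₁ (prop6Printed_zdCubP_anti (fun i : ZdIdx 4 F.L => i) hdvd hP6) hMc hc hc₀ ν g K k hρ s hsep hadm ε
    ha₀ hε hcomp U h17 h19 hj1 hjk a hdat

end Door

end Summit.QuantumFields.YangMills.BalabanUVNodes.N07DatumGauge152GuardedBox

end
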